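import Summits.NavierStokesRegularity.NavierStokesRegularity.Theorems.TaoForcedUniqueness.Negative.CountableJunkProfile
import Summits.NavierStokesRegularity.NavierStokesRegularity.Theorems.TaoForcedUniqueness.Negative.SaturatedPartition
import Mathlib.Analysis.Calculus.BumpFunction.Normed

/-!
# K54 (2/4): a countable family of `L²` directions orthogonal to `U`, total on `C_c(ℝ³)³` modulo `U`;
# the saturated labelling of times

Cell `ns-blowup`, seat `ns-blowup-refuter4` (g0), KILLSHEET §XXV row K54, part 2/4 of the kernel certificate
`¬ Literature.Analysis.FluidPDE.sohr2001_serrinMasuda_uniqueness_forced(_memLp)` (final file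
`SohrForcedUniquenessCountableJunk.lean` in this directory, which carries the full account). LABEL: refuter
construction (explicit data + proved lemmas; no named facts, no `sorry`). WHAT THIS IS NOT: not Navier–Stokes
evidence; nothing here mentions the summit.

Content: bumps `ρ_{q,i}` (Mathlib `ContDiffBump`) at rational centres with rational radii, the fields
`ρ e_j - c_{q,i,j} U` made orthogonal to `U` in `L²` and normalised into the unit ball, enumerated as
`junk : ℕ → (ℝ³ → ℝ³)` with `junk 0 = 0`; the TOTALITY lemma `eq_zero_of_forall_integral_inner_junk`: a
continuous compactly supported `φ` with `∫⟪junk n, φ⟫ = 0` for all `n` is `0` (it must be a multiple of `U`,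
and `U` is not compactly supported — part 1/4). Then the labelling `label : ℝ → ℕ` of the saturated countable
partition of the line (tree `SaturatedPartition.exists_saturated_partition`, Halmos 1950 §16 Thm. E).
[cite: Halmos1950, §16 Theorem E]
-/

noncomputable section

namespace Summit.NavierStokesRegularity.ForcedUniquenessCountableJunk

open MeasureTheory Set Filter Topology Function
open scoped ENNReal NNReal RealInnerProductSpace Laplacian
open Literature.Analysis.FluidPDE

/-! ## §5 A countable family of directions, orthogonal to `U` and total on `C_c(ℝ³)³` modulo `U` -/

/-- The point of `ℝ³` with rational coordinates `q`. [folklore] -/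
def ratPt (q : ℚ × ℚ × ℚ) : EuclideanSpace ℝ (Fin 3) :=
  (q.1 : ℝ) • e 0 + (q.2.1 : ℝ) • e 1 + (q.2.2 : ℝ) • e 2

/-- Every vector is the combination of the unit vectors with its coordinates. [folklore] -/
theorem eq_sum_smul_e (x : EuclideanSpace ℝ (Fin 3)) : x = x 0 • e 0 + x 1 • e 1 + x 2 • e 2 := by
  ext j
  fin_cases j <;> simp

/-- Rational points are dense: every ball contains one. [folklore] -/
theorem exists_ratPt_near (x : EuclideanSpace ℝ (Fin 3)) {ε : ℝ} (hε : 0 < ε) :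
    ∃ q : ℚ × ℚ × ℚ, dist (ratPt q) x < ε := by
  obtain ⟨q0, h0, h0'⟩ := exists_rat_btwn (show x 0 < x 0 + ε / 3 by linarith)
  obtain ⟨q1, h1, h1'⟩ := exists_rat_btwn (show x 1 < x 1 + ε / 3 by linarith)
  obtain ⟨q2, h2, h2'⟩ := exists_rat_btwn (show x 2 < x 2 + ε / 3 by linarith)
  refine ⟨(q0, q1, q2), ?_⟩
  rw [dist_eq_norm]
  have hx : ratPt (q0, q1, q2) - x =
      ((q0 : ℝ) - x 0) • e 0 + ((q1 : ℝ) - x 1) • e 1 + ((q2 : ℝ) - x 2) • e 2 := by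
    conv_lhs => rw [eq_sum_smul_e x]
    simp only [ratPt, sub_smul]
    abel
  rw [hx]
  calc ‖((q0 : ℝ) - x 0) • e 0 + ((q1 : ℝ) - x 1) • e 1 + ((q2 : ℝ) - x 2) • e 2‖
      ≤ ‖((q0 : ℝ) - x 0) • e 0‖ + ‖((q1 : ℝ) - x 1) • e 1‖ + ‖((q2 : ℝ) - x 2) • e 2‖ :=
        norm_add₃_le
    _ = |(q0 : ℝ) - x 0| + |(q1 : ℝ) - x 1| + |(q2 : ℝ) - x 2| := by simp [norm_smul]
    _ < ε / 3 + ε / 3 + ε / 3 := by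
        have a0 : |(q0 : ℝ) - x 0| < ε / 3 := abs_sub_lt_iff.2 ⟨by linarith, by linarith⟩
        have a1 : |(q1 : ℝ) - x 1| < ε / 3 := abs_sub_lt_iff.2 ⟨by linarith, by linarith⟩
        have a2 : |(q2 : ℝ) - x 2| < ε / 3 := abs_sub_lt_iff.2 ⟨by linarith, by linarith⟩
        linarith
    _ = ε := by ring

/-- The bump of the family: centred at the rational point `q`, radii `1/(n+2) < 2/(n+2)`. [folklore] -/
def bump (q : ℚ × ℚ × ℚ) (n : ℕ) : ContDiffBump (ratPt q) :=
  ⟨1 / ((n : ℝ) + 2), 2 / ((n : ℝ) + 2), by positivity, by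
    rw [div_lt_div_iff_of_pos_right (by positivity)]; norm_num⟩

/-- The vector bump `ρ_{q,n} e_j`. [folklore] -/
def bumpVec (i : (ℚ × ℚ × ℚ) × ℕ × Fin 3) (x : EuclideanSpace ℝ (Fin 3)) : EuclideanSpace ℝ (Fin 3) :=
  (bump i.1 i.2.1 : EuclideanSpace ℝ (Fin 3) → ℝ) x • e i.2.2

/-- The vector bumps are continuous. [folklore] -/
theorem continuous_bumpVec (i : (ℚ × ℚ × ℚ) × ℕ × Fin 3) : Continuous (bumpVec i) :=
  (bump i.1 i.2.1).continuous.smul continuous_const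

/-- The vector bumps are compactly supported. [folklore] -/
theorem hasCompactSupport_bumpVec (i : (ℚ × ℚ × ℚ) × ℕ × Fin 3) : HasCompactSupport (bumpVec i) :=
  (bump i.1 i.2.1).hasCompactSupport.smul_right 

/-- The vector bumps are in `L²`. [folklore] -/
theorem memLp_bumpVec (i : (ℚ × ℚ × ℚ) × ℕ × Fin 3) : MemLp (bumpVec i) 2 volume :=
  (continuous_bumpVec i).memLp_of_hasCompactSupport (hasCompactSupport_bumpVec i)

/-- The `L²` pairing with `U`. [folklore] -/
def pairU (g : EuclideanSpace ℝ (Fin 3) → EuclideanSpace ℝ (Fin 3)) : ℝ := ∫ x, ⟪g x, swirl x⟫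

/-- `‖U‖²_{L²}` as a real number. [folklore] -/
def normSqU : ℝ := ∫ x, ⟪swirl x, swirl x⟫

/-- The bump with its `U`-component removed: `ρ e_j - (⟪ρ e_j, U⟫/‖U‖²) U`. [folklore] -/
def projVec (i : (ℚ × ℚ × ℚ) × ℕ × Fin 3) (x : EuclideanSpace ℝ (Fin 3)) : EuclideanSpace ℝ (Fin 3) :=
  bumpVec i x - (pairU (bumpVec i) / normSqU) • swirl x

/-- `projVec` is continuous. [folklore] -/
theorem continuous_projVec (i : (ℚ × ℚ × ℚ) × ℕ × Fin 3) : Continuous (projVec i) := by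
  show Continuous fun x => bumpVec i x - (pairU (bumpVec i) / normSqU) • swirl x
  exact (continuous_bumpVec i).sub
    ((continuous_const (y := pairU (bumpVec i) / normSqU)).smul continuous_swirl)

/-- `projVec ∈ L²`. [folklore] -/
theorem memLp_projVec (i : (ℚ × ℚ × ℚ) × ℕ × Fin 3) : MemLp (projVec i) 2 volume := by
  have h := (memLp_bumpVec i).sub
    ((memLp_swirl (p := 2) le_rfl (by simp)).const_smul (pairU (bumpVec i) / normSqU))
  exact h

/-- `projVec ⊥ U` in `L²`. [folklore] -/
theorem integral_inner_projVec_swirl (i : (ℚ × ℚ × ℚ) × ℕ × Fin 3) :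
    ∫ x, ⟪projVec i x, swirl x⟫ = 0 := by
  have hU := memLp_swirl (p := 2) le_rfl (by simp)
  simp only [projVec, inner_sub_left, real_inner_smul_left]
  rw [integral_sub (integrable_inner_of_memLp_two (memLp_bumpVec i) hU)
    ((integrable_inner_of_memLp_two hU hU).const_mul _), integral_const_mul]
  have hpos := integral_inner_swirl_swirl_pos
  simp only [pairU, normSqU]
  field_simp
  ring

/-- The normalising factor `(1 + ‖projVec‖₂)⁻¹ ∈ (0, 1]`. [folklore] -/
def dirScale (i : (ℚ × ℚ × ℚ) × ℕ × Fin 3) : ℝ := (1 + (eLpNorm (projVec i) 2 volume).toReal)⁻¹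

/-- The normalising factor is positive. [folklore] -/
theorem dirScale_pos (i : (ℚ × ℚ × ℚ) × ℕ × Fin 3) : 0 < dirScale i := by
  unfold dirScale; positivity

/-- **The direction** `Φ_i = (1 + ‖projVec_i‖₂)⁻¹ projVec_i`: in the unit ball of `L²`, `⊥ U`. [folklore] -/
def dir (i : (ℚ × ℚ × ℚ) × ℕ × Fin 3) (x : EuclideanSpace ℝ (Fin 3)) : EuclideanSpace ℝ (Fin 3) :=
  dirScale i • projVec i x

/-- An enumeration of the (countable) index set. [folklore] -/
def idxEnum : ℕ → (ℚ × ℚ × ℚ) × ℕ × Fin 3 := (exists_surjective_nat ((ℚ × ℚ × ℚ) × ℕ × Fin 3)).choose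

/-- The enumeration is onto. [folklore] -/
theorem idxEnum_surjective : Surjective idxEnum :=
  (exists_surjective_nat ((ℚ × ℚ × ℚ) × ℕ × Fin 3)).choose_spec

/-- **The junk directions** `g_0 = 0`, `g_{n+1} = Φ_{ι(n)}`. [folklore] -/
def junk : ℕ → EuclideanSpace ℝ (Fin 3) → EuclideanSpace ℝ (Fin 3)
  | 0 => 0
  | n + 1 => dir (idxEnum n)

/-- The junk directions are continuous. [folklore] -/
theorem continuous_junk : ∀ n, Continuous (junk n)
  | 0 => continuous_const
  | n + 1 => by
    show Continuous fun x => dirScale (idxEnum n) • projVec (idxEnum n) x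
    exact (continuous_const (y := dirScale (idxEnum n))).smul (continuous_projVec _)

/-- The junk directions are in `L²`. [folklore] -/
theorem memLp_junk : ∀ n, MemLp (junk n) 2 volume
  | 0 => by
    show MemLp (0 : EuclideanSpace ℝ (Fin 3) → EuclideanSpace ℝ (Fin 3)) 2 volume
    exact MemLp.zero
  | n + 1 => by
    have h := (memLp_projVec (idxEnum n)).const_smul (dirScale (idxEnum n))
    exact h

/-- **The junk directions lie in the unit ball of `L²`.** [folklore] -/
theorem eLpNorm_junk_le_one : ∀ n, eLpNorm (junk n) 2 volume ≤ 1
  | 0 => by simp [junk]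
  | n + 1 => by
    have hN : eLpNorm (projVec (idxEnum n)) 2 volume ≠ ∞ := (memLp_projVec _).eLpNorm_ne_top
    have h : junk (n + 1) = dirScale (idxEnum n) • projVec (idxEnum n) := rfl
    rw [h, eLpNorm_const_smul, Real.enorm_eq_ofReal (dirScale_pos _).le,
      ← ENNReal.ofReal_toReal hN, ← ENNReal.ofReal_mul (dirScale_pos _).le,
      ENNReal.ofReal_le_one, dirScale]
    have hnn : 0 ≤ (eLpNorm (projVec (idxEnum n)) 2 volume).toReal := ENNReal.toReal_nonneg
    rw [inv_mul_le_iff₀ (by positivity)]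
    linarith

/-- **The junk directions are `L²`-orthogonal to `U`.** [folklore] -/
theorem integral_inner_junk_swirl : ∀ n, ∫ x, ⟪junk n x, swirl x⟫ = 0
  | 0 => by simp [junk]
  | n + 1 => by
    have h : ∀ x, junk (n + 1) x = dirScale (idxEnum n) • projVec (idxEnum n) x := fun x => rfl
    simp only [h, real_inner_smul_left, integral_const_mul, integral_inner_projVec_swirl, mul_zero]

/-- A continuous function that integrates to zero against every bump `ρ_{q,n}` vanishes:
the rational balls `B(q, 2/(n+2))` form a neighbourhood basis and `ρ_{q,n} > 0` on its ball. [folklore] -/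
theorem eq_zero_of_forall_integral_bump_mul {g : EuclideanSpace ℝ (Fin 3) → ℝ} (hg : Continuous g)
    (h : ∀ (q : ℚ × ℚ × ℚ) (n : ℕ), ∫ x, (bump q n : EuclideanSpace ℝ (Fin 3) → ℝ) x * g x = 0)
    (x₀ : EuclideanSpace ℝ (Fin 3)) : g x₀ = 0 := by
  by_contra hne
  -- `g' := g x₀ * g` is positive at `x₀`
  have hpos : 0 < g x₀ * g x₀ := mul_self_pos.2 hne
  have hcont : Continuous fun x => g x₀ * g x := continuous_const.mul hg
  have hev : ∀ᶠ x in 𝓝 x₀, g x₀ * g x₀ / 2 < g x₀ * g x :=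
    (hcont.tendsto x₀).eventually_const_lt (half_lt_self hpos)
  obtain ⟨δ, hδ, hball⟩ := Metric.eventually_nhds_iff.1 hev
  obtain ⟨q, hq⟩ := exists_ratPt_near x₀ (half_pos hδ)
  obtain ⟨n, hn⟩ := exists_nat_gt (4 / δ)
  have hrOut : (bump q n).rOut = 2 / ((n : ℝ) + 2) := rfl
  have hr : 2 / ((n : ℝ) + 2) < δ / 2 := by
    rw [div_lt_iff₀ (by positivity)]
    have : 4 / δ * δ = 4 := div_mul_cancel₀ _ hδ.ne'
    nlinarith
  -- the ball of the bump lies where `g' > 0`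
  have hsub : ∀ x ∈ Metric.ball (ratPt q) (bump q n).rOut, 0 < g x₀ * g x := by
    intro x hx
    rw [hrOut, Metric.mem_ball] at hx
    have hx' : dist x x₀ < δ := by
      calc dist x x₀ ≤ dist x (ratPt q) + dist (ratPt q) x₀ := dist_triangle _ _ _
        _ < δ / 2 + δ / 2 := add_lt_add (hx.trans hr) hq
        _ = δ := by ring
    linarith [hball hx']
  -- the integrand `ρ * g'` is nonnegative and positive on the ball
  have hnn : 0 ≤ fun x => (bump q n : EuclideanSpace ℝ (Fin 3) → ℝ) x * (g x₀ * g x) := by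
    intro x
    by_cases hx : x ∈ Metric.ball (ratPt q) (bump q n).rOut
    · exact mul_nonneg (bump q n).nonneg (hsub x hx).le
    · have : (bump q n : EuclideanSpace ℝ (Fin 3) → ℝ) x = 0 := by
        rw [← Function.notMem_support, (bump q n).support_eq]; exact hx
      simp [this]
  have hint : Integrable (fun x => (bump q n : EuclideanSpace ℝ (Fin 3) → ℝ) x * (g x₀ * g x)) :=
    ((bump q n).continuous.mul hcont).integrable_of_hasCompactSupport
      ((bump q n).hasCompactSupport.mul_right)
  have hI : 0 < ∫ x, (bump q n : EuclideanSpace ℝ (Fin 3) → ℝ) x * (g x₀ * g x) := by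
    rw [integral_pos_iff_support_of_nonneg hnn hint]
    refine lt_of_lt_of_le (Metric.measure_ball_pos volume (ratPt q) (bump q n).rOut_pos)
      (measure_mono fun x hx => ?_)
    rw [Function.mem_support]
    exact mul_ne_zero ((bump q n).pos_of_mem_ball hx).ne' (hsub x hx).ne'
  have hzero : ∫ x, (bump q n : EuclideanSpace ℝ (Fin 3) → ℝ) x * (g x₀ * g x) = 0 := by
    have h' := h q n
    calc ∫ x, (bump q n : EuclideanSpace ℝ (Fin 3) → ℝ) x * (g x₀ * g x)
        = g x₀ * ∫ x, (bump q n : EuclideanSpace ℝ (Fin 3) → ℝ) x * g x := by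
          rw [← integral_const_mul]
          exact integral_congr_ae (Eventually.of_forall fun x => by simp only; ring)
      _ = 0 := by rw [h', mul_zero]
  exact hI.ne' hzero

/-- **Totality.** A continuous compactly supported field that is `L²`-orthogonal to every junk
direction is zero: orthogonality to all `Φ_i` forces `φ - αU ⊥ ρ_{q,n} e_j` for all bumps, hence
`φ = αU`; and `U` is not compactly supported, so `α = 0`. [folklore] -/
theorem eq_zero_of_forall_integral_inner_junk {φ : EuclideanSpace ℝ (Fin 3) → EuclideanSpace ℝ (Fin 3)}
    (hφ : Continuous φ) (hφc : HasCompactSupport φ) (h : ∀ n, ∫ x, ⟪junk n x, φ x⟫ = 0) :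
    φ = 0 := by
  have hU := memLp_swirl (p := 2) le_rfl (by simp)
  have hφ2 : MemLp φ 2 volume := hφ.memLp_of_hasCompactSupport hφc
  set α : ℝ := (∫ x, ⟪swirl x, φ x⟫) / normSqU with hα
  -- Step 1: every bump is orthogonal to `φ - α U`
  have h1 : ∀ i : (ℚ × ℚ × ℚ) × ℕ × Fin 3, ∫ x, ⟪bumpVec i x, φ x - α • swirl x⟫ = 0 := by
    intro i
    obtain ⟨n, hn⟩ := idxEnum_surjective i
    have e1 := h (n + 1)
    have hj : ∀ x, junk (n + 1) x = dirScale i • (bumpVec i x - (pairU (bumpVec i) / normSqU) • swirl x) :=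
      fun x => by simp only [junk, dir, projVec, hn]
    simp only [hj, real_inner_smul_left, integral_const_mul, inner_sub_left] at e1
    have e2 := (mul_eq_zero.1 e1).resolve_left (dirScale_pos i).ne'
    rw [integral_sub (integrable_inner_of_memLp_two (memLp_bumpVec i) hφ2)
      ((integrable_inner_of_memLp_two hU hφ2).const_mul _), integral_const_mul, sub_eq_zero] at e2
    simp only [inner_sub_right, real_inner_smul_right]
    rw [integral_sub (integrable_inner_of_memLp_two (memLp_bumpVec i) hφ2)
      ((integrable_inner_of_memLp_two (memLp_bumpVec i) hU).const_mul _), integral_const_mul, e2,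
      hα, pairU]
    have hpos := integral_inner_swirl_swirl_pos
    rw [normSqU]
    field_simp
    ring
  -- Step 2: components of `φ - α U` vanish
  have h2 : ∀ (j : Fin 3) (x : EuclideanSpace ℝ (Fin 3)), (φ x - α • swirl x) j = 0 := by
    intro j
    refine eq_zero_of_forall_integral_bump_mul
      ((EuclideanSpace.proj j).continuous.comp (hφ.sub (continuous_swirl.const_smul α))) ?_
    intro q n
    have := h1 (q, n, j)
    simpa [bumpVec, real_inner_smul_left, e, EuclideanSpace.inner_single_left] using this
  -- Step 3: `φ = α U`
  have h3 : ∀ x, φ x = α • swirl x := fun x =>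
    sub_eq_zero.1 (PiLp.ext fun j => by simpa using h2 j x)
  -- Step 4: `α = 0` since `U` is not compactly supported
  obtain ⟨x₁, hx₁, hU₁⟩ := exists_swirl_ne_zero_not_mem hφc
  have hφx₁ : φ x₁ = 0 := Function.notMem_support.1 (fun hx => hx₁ (subset_tsupport _ hx))
  have hα0 : α = 0 := by
    have := h3 x₁
    rw [hφx₁, eq_comm, smul_eq_zero] at this
    exact this.resolve_right hU₁
  funext x
  rw [h3 x, hα0, zero_smul, Pi.zero_apply]

/-! ## §3 The saturated labelling of times (tree: `SaturatedPartition`) -/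

/-- The pieces of the saturated countable partition of the line (tree
`ForcedUniquenessHygiene.exists_saturated_partition`; a choice). [cite: Halmos1950, §16 Theorem E] -/
def piece : ℕ → Set ℝ := ForcedUniquenessHygiene.exists_saturated_partition.choose

/-- The pieces are pairwise disjoint, cover the line, and each is saturated from outside. [folklore] -/
theorem piece_spec : Pairwise (Function.onFun Disjoint piece) ∧ (⋃ m, piece m) = univ ∧
    ∀ (m : ℕ) (F : Set ℝ), MeasurableSet F → F ⊆ (piece m)ᶜ → volume F = 0 :=
  ForcedUniquenessHygiene.exists_saturated_partition.choose_spec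

/-- Every time lies in some piece. [folklore] -/
theorem exists_mem_piece (t : ℝ) : ∃ m, t ∈ piece m := by
  have h : t ∈ ⋃ m, piece m := by rw [piece_spec.2.1]; exact mem_univ t
  exact mem_iUnion.1 h

/-- **The labelling** `ℓ(t)` = the index of the piece containing `t` (not measurable: every level set
is saturated). [folklore] -/
def label (t : ℝ) : ℕ := (exists_mem_piece t).choose

/-- `ℓ` labels the pieces. [folklore] -/
theorem label_eq_of_mem (m : ℕ) (t : ℝ) (ht : t ∈ piece m) : label t = m := by
  have h : t ∈ piece (label t) := (exists_mem_piece t).choose_spec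
  by_contra hne
  exact Set.disjoint_left.1 (piece_spec.1 hne) h ht

end Summit.NavierStokesRegularity.ForcedUniquenessCountableJunk

end
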